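import Mathlib
import Summits.MatrixMultiplication.MatrixMultiplication.Theorems.SoloBlindAmalgam

/-!
# A zero-sum-free SET of 24 vectors in `𝔽₃¹²` with fourteen 4-subsets of equal sum, certified by amalgamation (solo-blind, s79)

Squarefree `L(4)`: for zero-sum-free SETS over `𝔽₃` the number of 4-subsets with a common sum is at
most `14` in every rank (complete census, s79), against `16` for sequences.  This file certifies the
lower bound `14` in the kernel WITHOUT enumerating the `2^24` subsets of the witness: the witness is the
amalgam of two `H`-good zero-sum-free blocks (`11` vectors with seven representing 4-subsets inside
`𝔽₃ × 𝔽₃⁵ × 0`, `13` vectors with seven inside `𝔽₃ × 0 × 𝔽₃⁶`) whose generated subgroups meet in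
`{0, τ, -τ}`, `τ = (1, 0, 0)`; the blocks are checked by `decide` (`2^11` and `2^13` index subsets) and the
union by `soloBlind_amalgam_zsf` / `soloBlind_amalgam_card`.  The union has `24 = 2 · 12` elements, the
maximal length of a zero-sum-free sequence over `𝔽₃¹²`.
-/

namespace Summit.MatrixMultiplication.MatrixMultiplication.Theorems

open Finset

section
/- `DecidableEq` of the twelve-component product exceeds the default instance size bound. -/
set_option synthInstance.maxSize 4096

/-- `𝔽₃⁵` as a nested product. -/
abbrev SoloBlindAmG5 : Type := ZMod 3 × ZMod 3 × ZMod 3 × ZMod 3 × ZMod 3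
/-- `𝔽₃⁶` as a nested product. -/
abbrev SoloBlindAmG6 : Type := ZMod 3 × ZMod 3 × ZMod 3 × ZMod 3 × ZMod 3 × ZMod 3
/-- `𝔽₃¹² = 𝔽₃ × 𝔽₃⁵ × 𝔽₃⁶` (the `τ`-line, the private coordinates of block A, those of block B). -/
abbrev SoloBlindAmG12 : Type := ZMod 3 × SoloBlindAmG5 × SoloBlindAmG6

/-- Block A: eleven vectors inside `𝔽₃ × 𝔽₃⁵ × 0`. -/
def soloBlindAm_hA : Fin 11 → SoloBlindAmG12 :=
  ![(0, (1, 0, 0, 0, 0), (0, 0, 0, 0, 0, 0)),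
    (0, (0, 1, 0, 0, 0), (0, 0, 0, 0, 0, 0)),
    (0, (0, 0, 1, 0, 0), (0, 0, 0, 0, 0, 0)),
    (1, (2, 2, 2, 0, 0), (0, 0, 0, 0, 0, 0)),
    (0, (0, 0, 0, 1, 0), (0, 0, 0, 0, 0, 0)),
    (1, (2, 2, 0, 2, 0), (0, 0, 0, 0, 0, 0)),
    (0, (0, 0, 0, 0, 1), (0, 0, 0, 0, 0, 0)),
    (1, (0, 0, 2, 2, 2), (0, 0, 0, 0, 0, 0)),
    (0, (0, 1, 1, 0, 2), (0, 0, 0, 0, 0, 0)),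
    (1, (2, 2, 2, 2, 1), (0, 0, 0, 0, 0, 0)),
    (2, (1, 1, 2, 0, 1), (0, 0, 0, 0, 0, 0))]

/-- Block B: thirteen vectors inside `𝔽₃ × 0 × 𝔽₃⁶`. -/
def soloBlindAm_hB : Fin 13 → SoloBlindAmG12 :=
  ![(0, (0, 0, 0, 0, 0), (1, 0, 0, 0, 0, 0)),
    (0, (0, 0, 0, 0, 0), (0, 1, 0, 0, 0, 0)),
    (0, (0, 0, 0, 0, 0), (0, 0, 1, 0, 0, 0)),
    (1, (0, 0, 0, 0, 0), (2, 2, 2, 0, 0, 0)),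
    (0, (0, 0, 0, 0, 0), (0, 0, 0, 1, 0, 0)),
    (0, (0, 0, 0, 0, 0), (0, 0, 0, 0, 1, 0)),
    (1, (0, 0, 0, 0, 0), (2, 0, 0, 2, 2, 0)),
    (0, (0, 0, 0, 0, 0), (0, 0, 0, 0, 0, 1)),
    (1, (0, 0, 0, 0, 0), (2, 2, 0, 0, 0, 2)),
    (1, (0, 0, 0, 0, 0), (2, 0, 2, 2, 0, 0)),
    (1, (0, 0, 0, 0, 0), (2, 0, 0, 0, 2, 2)),
    (1, (0, 0, 0, 0, 0), (0, 2, 2, 0, 2, 0)),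
    (1, (0, 0, 0, 0, 0), (0, 2, 0, 2, 0, 2))]

/-- The common target `τ = (1, 0, 0)`. -/
def soloBlindAm_tau : SoloBlindAmG12 := (1, (0, 0, 0, 0, 0), (0, 0, 0, 0, 0, 0))

/-- Block A as a set of vectors. -/
def soloBlindAm_SA : Finset SoloBlindAmG12 := univ.image soloBlindAm_hA
/-- Block B as a set of vectors. -/
def soloBlindAm_SB : Finset SoloBlindAmG12 := univ.image soloBlindAm_hB

/-! ### General transfer lemmas: index-level facts about an injective family give set-level facts -/

section transfer
variable {G : Type*} [AddCommGroup G] [DecidableEq G] {ι : Type*} [Fintype ι]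

/-- Zero-sum-freeness transfers from an injective family to its image set. -/
theorem soloBlind_zsf_of_image (f : ι → G) (hf : Function.Injective f)
    (z : ∀ I : Finset ι, ∑ i ∈ I, f i = 0 → I = ∅) :
    ∀ T ⊆ (univ : Finset ι).image f, ∑ x ∈ T, x = 0 → T = ∅ := by
  intro T hT h0
  obtain ⟨I, -, rfl⟩ := Finset.subset_image_iff.mp hT
  rw [Finset.sum_image (fun x _ y _ h => hf h)] at h0
  rw [z I h0, Finset.image_empty]

/-- `H`-goodness (no subset sums to `-τ`) transfers from an injective family to its image set. -/
theorem soloBlind_hgood_of_image (f : ι → G) (hf : Function.Injective f) (τ : G)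
    (g : ∀ I : Finset ι, ∑ i ∈ I, f i ≠ -τ) :
    ∀ T ⊆ (univ : Finset ι).image f, ∑ x ∈ T, x ≠ -τ := by
  intro T hT
  obtain ⟨I, -, rfl⟩ := Finset.subset_image_iff.mp hT
  rw [Finset.sum_image (fun x _ y _ h => hf h)]
  exact g I

/-- The size-`k` representations of `τ` inside the image set are counted at index level. -/
theorem soloBlind_repAll_card_image (f : ι → G) (hf : Function.Injective f) (τ : G) (k : ℕ) :
    ((soloBlindRepAll ((univ : Finset ι).image f) τ).filter (fun T => T.card = k)).card =
      ((univ : Finset ι).powerset.filter (fun I => I.card = k ∧ ∑ i ∈ I, f i = τ)).card := by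
  have key : (soloBlindRepAll ((univ : Finset ι).image f) τ).filter (fun T => T.card = k) =
      ((univ : Finset ι).powerset.filter (fun I => I.card = k ∧ ∑ i ∈ I, f i = τ)).image
        (fun I => I.image f) := by
    ext T
    simp only [Finset.mem_filter, soloBlind_mem_repAll, Finset.mem_image, Finset.mem_powerset]
    constructor
    · rintro ⟨⟨hT, hs⟩, hc⟩
      obtain ⟨I, -, rfl⟩ := Finset.subset_image_iff.mp hT
      refine ⟨I, ⟨Finset.subset_univ _, ?_, ?_⟩, rfl⟩
      · rw [← hc, Finset.card_image_of_injective _ hf]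
      · rw [← hs, Finset.sum_image (fun x _ y _ h => hf h)]
    · rintro ⟨I, ⟨-, hc, hs⟩, rfl⟩
      refine ⟨⟨Finset.image_subset_image (Finset.subset_univ _), ?_⟩, ?_⟩
      · rw [Finset.sum_image (fun x _ y _ h => hf h)]; exact hs
      · rw [Finset.card_image_of_injective _ hf]; exact hc
  rw [key, Finset.card_image_of_injective _ (Finset.image_injective hf)]

end transfer

/-! ### The two blocks, by `decide` -/

/-- Block A is injective (eleven distinct vectors). -/
theorem soloBlindAm_hA_injective : Function.Injective soloBlindAm_hA := by decide +kernel
/-- Block B is injective (thirteen distinct vectors). -/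
theorem soloBlindAm_hB_injective : Function.Injective soloBlindAm_hB := by decide +kernel

set_option maxHeartbeats 0 in
/-- Block A is zero-sum free (all `2^11` index subsets). -/
theorem soloBlindAm_hA_zsf : ∀ I : Finset (Fin 11), ∑ i ∈ I, soloBlindAm_hA i = 0 → I = ∅ := by
  decide +kernel

set_option maxHeartbeats 0 in
/-- Block B is zero-sum free (all `2^13` index subsets). -/
theorem soloBlindAm_hB_zsf : ∀ I : Finset (Fin 13), ∑ i ∈ I, soloBlindAm_hB i = 0 → I = ∅ := by
  decide +kernel

set_option maxHeartbeats 0 in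
/-- Block A is `H`-good: no index subset sums to `-τ`. -/
theorem soloBlindAm_hA_hgood : ∀ I : Finset (Fin 11), ∑ i ∈ I, soloBlindAm_hA i ≠ -soloBlindAm_tau := by
  decide +kernel

set_option maxHeartbeats 0 in
/-- Block B is `H`-good: no index subset sums to `-τ`. -/
theorem soloBlindAm_hB_hgood : ∀ I : Finset (Fin 13), ∑ i ∈ I, soloBlindAm_hB i ≠ -soloBlindAm_tau := by
  decide +kernel

set_option maxHeartbeats 0 in
/-- Block A represents `τ` by exactly seven 4-subsets. -/
theorem soloBlindAm_hA_seven : ((univ : Finset (Fin 11)).powerset.filter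
    (fun I => I.card = 4 ∧ ∑ i ∈ I, soloBlindAm_hA i = soloBlindAm_tau)).card = 7 := by
  decide +kernel

set_option maxHeartbeats 0 in
/-- Block B represents `τ` by exactly seven 4-subsets. -/
theorem soloBlindAm_hB_seven : ((univ : Finset (Fin 13)).powerset.filter
    (fun I => I.card = 4 ∧ ∑ i ∈ I, soloBlindAm_hB i = soloBlindAm_tau)).card = 7 := by
  decide +kernel

/-- The two blocks are disjoint sets of vectors, of sizes 11 and 13. -/
theorem soloBlindAm_disjoint : Disjoint soloBlindAm_SA soloBlindAm_SB ∧
    soloBlindAm_SA.card = 11 ∧ soloBlindAm_SB.card = 13 ∧ (soloBlindAm_SA ∪ soloBlindAm_SB).card = 24 := by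
  unfold soloBlindAm_SA soloBlindAm_SB; decide +kernel

/-- `τ` is a sum of four vectors of block B, hence lies in the subgroup block B generates. -/
theorem soloBlindAm_tau_mem_closureB :
    soloBlindAm_tau ∈ AddSubgroup.closure (soloBlindAm_SB : Set SoloBlindAmG12) := by
  have e : soloBlindAm_tau = soloBlindAm_hB 0 + soloBlindAm_hB 1 + soloBlindAm_hB 2 + soloBlindAm_hB 3 := by
    decide
  have m : ∀ i, soloBlindAm_hB i ∈ AddSubgroup.closure (soloBlindAm_SB : Set SoloBlindAmG12) := fun i =>
    AddSubgroup.subset_closure (Finset.mem_coe.mpr (Finset.mem_image_of_mem _ (Finset.mem_univ i)))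
  rw [e]
  exact AddSubgroup.add_mem _ (AddSubgroup.add_mem _ (AddSubgroup.add_mem _ (m 0) (m 1)) (m 2)) (m 3)

/-- The projection of `𝔽₃ × 𝔽₃⁵ × 𝔽₃⁶` onto the block-B coordinates `𝔽₃⁶`. -/
def soloBlindAm_piB : SoloBlindAmG12 →+ SoloBlindAmG6 :=
  (AddMonoidHom.snd SoloBlindAmG5 SoloBlindAmG6).comp (AddMonoidHom.snd (ZMod 3) (SoloBlindAmG5 × SoloBlindAmG6))
/-- The projection of `𝔽₃ × 𝔽₃⁵ × 𝔽₃⁶` onto the block-A coordinates `𝔽₃⁵`. -/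
def soloBlindAm_piA : SoloBlindAmG12 →+ SoloBlindAmG5 :=
  (AddMonoidHom.fst SoloBlindAmG5 SoloBlindAmG6).comp (AddMonoidHom.snd (ZMod 3) (SoloBlindAmG5 × SoloBlindAmG6))

/-- Block A generates a subgroup with vanishing block-B coordinates. -/
theorem soloBlindAm_closureA_le : AddSubgroup.closure (soloBlindAm_SA : Set SoloBlindAmG12) ≤ soloBlindAm_piB.ker := by
  rw [AddSubgroup.closure_le]
  intro x hx
  simp only [soloBlindAm_SA, Finset.coe_image, Finset.coe_univ, Set.image_univ, Set.mem_range] at hx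
  obtain ⟨i, rfl⟩ := hx
  rw [SetLike.mem_coe, AddMonoidHom.mem_ker]
  revert i; decide

/-- Block B generates a subgroup with vanishing block-A coordinates. -/
theorem soloBlindAm_closureB_le : AddSubgroup.closure (soloBlindAm_SB : Set SoloBlindAmG12) ≤ soloBlindAm_piA.ker := by
  rw [AddSubgroup.closure_le]
  intro x hx
  simp only [soloBlindAm_SB, Finset.coe_image, Finset.coe_univ, Set.image_univ, Set.mem_range] at hx
  obtain ⟨i, rfl⟩ := hx
  rw [SetLike.mem_coe, AddMonoidHom.mem_ker]
  revert i; decide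

/-- MEET CONDITION: the subgroups generated by the two blocks meet inside `{0, τ, -τ}`. -/
theorem soloBlindAm_meet : ∀ g ∈ AddSubgroup.closure (soloBlindAm_SA : Set SoloBlindAmG12),
    g ∈ AddSubgroup.closure (soloBlindAm_SB : Set SoloBlindAmG12) →
      g = 0 ∨ g = soloBlindAm_tau ∨ g = -soloBlindAm_tau := by
  intro g hA hB
  have h1 : soloBlindAm_piB g = 0 := soloBlindAm_closureA_le hA
  have h2 : soloBlindAm_piA g = 0 := soloBlindAm_closureB_le hB
  obtain ⟨c, a, b⟩ := g
  simp only [soloBlindAm_piB, soloBlindAm_piA, AddMonoidHom.coe_comp, Function.comp_apply,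
    AddMonoidHom.coe_snd, AddMonoidHom.coe_fst] at h1 h2
  subst h1; subst h2
  have hc : ∀ c : ZMod 3, c = 0 ∨ c = 1 ∨ c = -1 := by decide
  rcases hc c with rfl | rfl | rfl
  · left; decide
  · right; left; decide
  · right; right; decide

/-- THE AMALGAM: `S_A ∪ S_B` is a zero-sum-free set of 24 vectors in `𝔽₃¹²` with exactly `7 + 7 = 14`
four-subsets of sum `τ` — the squarefree constant at `k = 4` is at least `14` (kernel), and equals `14`
by the complete census. -/
theorem soloBlind_squarefree_L4_fourteen :
    (∀ T ⊆ soloBlindAm_SA ∪ soloBlindAm_SB, ∑ x ∈ T, x = 0 → T = ∅) ∧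
    (soloBlindAm_SA ∪ soloBlindAm_SB).card = 24 ∧
    ((soloBlindRepAll (soloBlindAm_SA ∪ soloBlindAm_SB) soloBlindAm_tau).filter
      (fun T => T.card = 4)).card = 14 := by
  have zA := soloBlind_zsf_of_image _ soloBlindAm_hA_injective soloBlindAm_hA_zsf
  have zB := soloBlind_zsf_of_image _ soloBlindAm_hB_injective soloBlindAm_hB_zsf
  have gA := soloBlind_hgood_of_image _ soloBlindAm_hA_injective _ soloBlindAm_hA_hgood
  have gB := soloBlind_hgood_of_image _ soloBlindAm_hB_injective _ soloBlindAm_hB_hgood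
  refine ⟨soloBlind_amalgam_zsf zA zB gA gB soloBlindAm_meet, soloBlindAm_disjoint.2.2.2, ?_⟩
  have cA := soloBlind_repAll_card_image _ soloBlindAm_hA_injective soloBlindAm_tau 4
  have cB := soloBlind_repAll_card_image _ soloBlindAm_hB_injective soloBlindAm_tau 4
  rw [soloBlindAm_hA_seven] at cA
  rw [soloBlindAm_hB_seven] at cB
  rw [soloBlind_amalgam_card soloBlindAm_disjoint.1 zA zB gA soloBlindAm_meet soloBlindAm_tau_mem_closureB 4]
  unfold soloBlindAm_SA soloBlindAm_SB
  rw [cA, cB]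

end

end Summit.MatrixMultiplication.MatrixMultiplication.Theorems
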